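import Summits.AnomalousDissipation.AnomalousDissipation.Theorems.BaireTransferDenseLoudDesignerForcesErgodicLine
import Literature.Analysis.FluidPDE.StokesTorusSqrtResolvent

/-!
# The V-frame smoothing isomorphism `(1 + A)^{-1/2}` on `H` (line `ergodic-budget-selection-closing`,
# crux `BaireTransfer.DenseLoudDesignerForces`, stmt-AnomalousDissipation-1143) — tools stub N0g of block N

Sorry-free file over the landed vocabulary `…ErgodicLine.lean` (`Hsp = Torus.energySpace (Fin 3)`) and the landed
square root of the Stokes resolvent on the torus energy space (`Literature/Analysis/FluidPDE/StokesTorusSqrtResolvent.lean`: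
`Torus.exists_stokesSqrtResolvent d`).  Block N of the line conjugates the Navier–Stokes strong-solution semiflow by the
smoothing isomorphism `Smap := S = (1 + A)^{-1/2} : H → V = D(A^{1/2})` (`A = Torus.stokesOperatorH (Fin 3)`, the Stokes
operator on the mean-zero solenoidal energy space; Constantin–Foias 1988, Ch. 4) so that it becomes a smooth local
semiflow in the `V`-frame, where all the landed linearisation estimates live; this file supplies `S`, its square
`R = S ∘ S = (1 + A)⁻¹` (the `H²`-frame resolvent of the sibling stub `stub_stokesResolventTools`) and the frame identity:

* `stub_sqrtResolventTools` (the REGISTERED tools stub, proved) — there are `S R : H →L[ℝ] H` with `S ∘ S = R`, `S`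
  injective, of norm `≤ 1`, self-adjoint and compact, `R v ∈ D(A)` and `R v + A (R v) = v` for every `v ∈ H`,
  `R (v + A v) = v` for every `v ∈ D(A)`, and `‖z‖² = ‖S z‖² + ⟪A (S z), S z⟫` whenever `S z ∈ D(A)` (the case
  `d = Fin 3` of `Torus.exists_stokesSqrtResolvent`).

References: P. Constantin, C. Foias, *Navier–Stokes Equations* (Univ. Chicago Press 1988), Ch. 4, (4.4)–(4.7),
(4.11)–(4.13) (`V = D(A^{1/2})`); M. Reed, B. Simon, *Methods of Modern Mathematical Physics I* (1980), §VIII.3.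
Nothing is asserted; no definition is added.
-/

-- `Summit.<Summit>.<Problem>` is the tree's mandated summit-side namespace (CONVENTIONS §2); for this
-- single-conjunct summit the two coincide, so the duplicate is deliberate.
set_option linter.dupNamespace false

noncomputable section

open scoped InnerProductSpace

namespace Summit.AnomalousDissipation.AnomalousDissipation.Theorems.DenseLoudDesignerForces.Ergodic

open Literature.Analysis.FunctionSpaces Literature.Analysis.FunctionSpaces.Torus
open Literature.Analysis.FluidPDE Literature.Analysis.FluidPDE.Torus

/-- **Tools stub N0g — the V-frame smoothing isomorphism `Smap = S = (1 + A)^{-1/2}` on `H`.**  With `A` the Stokes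
operator on the energy space (`Torus.stokesOperatorH (Fin 3)`, self-adjoint, positive, diagonal in the Stokes eigenbasis
with eigenvalues `4π²|k|² → ∞`: `exists_hilbertBasis_stokes_holds`), `S := (1 + A)^{-1/2}` (diagonal with symbol
`(1 + 4π²|k|²)^{-1/2}`) is an injective self-adjoint compact contraction of `H` whose square `R = S ∘ S = (1 + A)⁻¹` maps
`H` into `D(A)` with `(1 + A) R = 1` on `H` and `R (1 + A) = 1` on `D(A)`, and the frame identity
`‖z‖² = ‖S z‖² + ⟪A (S z), S z⟫` holds whenever `S z ∈ D(A)` (coefficientwise `1 = (1+m)⁻¹ + m (1+m)⁻¹`): the model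
norm `‖S⁻¹ v‖` is the `V`-norm `(‖v‖² + ‖∇v‖₂²)^{1/2}` (Constantin–Foias 1988 Ch. 4, `V = D(A^{1/2})`, (4.4)–(4.7),
(4.11)–(4.13); the tree's `Torus.exists_stokesSqrtResolvent` at `d = Fin 3`).
[cite: ConstantinFoiasNSE1988, Ch. 4 (the spaces V = D(A^{1/2}), (4.11)–(4.13))] -/
theorem stub_sqrtResolventTools :
    ∃ S R : Hsp →L[ℝ] Hsp, S.comp S = R ∧ Function.Injective S ∧ ‖S‖ ≤ 1 ∧ IsSelfAdjoint S ∧ IsCompactOperator S ∧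
      (∀ v : Hsp, ∃ hv : R v ∈ (stokesOperatorH (Fin 3)).domain, R v + stokesOperatorH (Fin 3) ⟨R v, hv⟩ = v) ∧
      (∀ (v : Hsp) (hv : v ∈ (stokesOperatorH (Fin 3)).domain), R (v + stokesOperatorH (Fin 3) ⟨v, hv⟩) = v) ∧
      (∀ (z : Hsp) (hz : S z ∈ (stokesOperatorH (Fin 3)).domain),
        ‖z‖ ^ 2 = ‖S z‖ ^ 2 + ⟪stokesOperatorH (Fin 3) ⟨S z, hz⟩, S z⟫_ℝ) :=
  exists_stokesSqrtResolvent (Fin 3)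

end Summit.AnomalousDissipation.AnomalousDissipation.Theorems.DenseLoudDesignerForces.Ergodic
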